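import Summits.Ventures.LatticeQCDFlow.Scoring.OnePlaquetteSU3Bessel
import Mathlib.Analysis.Calculus.ParametricIntegral
import Mathlib.Analysis.Calculus.Deriv.MeanValue
import HarnessLib

/-!
# The SU(3) one-plaquette free energy: `Z₃ > 0`, `Z₃' = ∫∫ plaq |Δ|² e^{(β/3) Re tr U}`, `⟨plaq⟩_β = (log Z₃)'(β)` is non-decreasing, with derivative the plaquette variance

HONEST FRAMING: exact (Metropolis-corrected) sampling algorithms for lattice gauge theory;
figures of merit are autocorrelation/cost numbers at stated couplings and volumes; no
continuum-physics claim.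

Venture `LatticeQCDFlow` (cell pub-lqcd), sub-topic `Scoring`; FANOUT row 5 (`s0-sun-a`, S0-C
implementation A — the 'exact 2-d plaquette oracle' column), GEN-16.  NEW WORK of the cell (placement
rule); the calculus companion of `OnePlaquetteSU3Bessel.lean` / `OnePlaquetteSU3PlaquetteBessel.lean`
for GEN-6's Weyl-torus SU(3) one-plaquette law (`onePlaquetteZSU3`, `onePlaquetteExpectSU3`, `plaqSU3`):

* §1 `weylSU3_le` (`|Δ|² ≤ 64`), `onePlaquetteZSU3_ge` (`Z₃(β) ≥ 6(2π)² e^{−|β|}`) and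
  **`onePlaquetteZSU3_pos`** (`Z₃ > 0`, so far only implicit in the enclosure checker);
* §2 **`hasDerivAt_integral2_weight`** — differentiation under the (iterated) integral sign for the
  Wilson weight: for bounded jointly continuous `g`,
  `d/dβ ∫∫ g |Δ|² e^{(β/3) Re tr U} = ∫∫ g · plaq · |Δ|² e^{(β/3) Re tr U}` (via the torus box of
  `OnePlaquetteSU3Bessel.integral2_eq_setIntegral_u1TorusBox` and Mathlib's dominated
  `hasDerivAt_integral_of_dominated_loc_of_deriv_le`, majorant `B · 64 · e^{|β|+1}` on the unit ball);
  hence `hasDerivAt_onePlaquetteZSU3` (`Z₃'(β)` = the plaquette numerator) and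
  `hasDerivAt_plaqSU3_numerator` (its derivative = the `plaq²` numerator);
* §3 **`onePlaquetteExpectSU3_plaqSU3_eq_deriv_log`** — `⟨(1/3) Re tr U_p⟩_β = (d/dβ) log Z₃(β)`;
  **`hasDerivAt_onePlaquetteExpectSU3_plaqSU3`** — `d⟨plaq⟩_β/dβ = ⟨plaq²⟩_β − ⟨plaq⟩_β²`;
  `onePlaquetteExpectSU3_plaqSU3_sq_le` — the variance is `≥ 0`; hence
  **`monotone_onePlaquetteExpectSU3_plaqSU3`** — THE SU(3) ONE-PLAQUETTE PLAQUETTE IS NON-DECREASING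
  IN `β`; with `onePlaquetteExpectSU3_plaqSU3_zero` (`⟨plaq⟩_0 = 0`, GEN-6's `∫∫ |Δ|² Re tr U = 0`) the
  sign statements `⟨plaq⟩_β ≥ 0` for `β ≥ 0`, `≤ 0` for `β ≤ 0`.

Combined with `OnePlaquetteSU3Bessel.onePlaquetteZSU3_eq_tsum_det` this is the strong-coupling
literature's `u(β) = (d/dβ) log Σ_q det[I_{q+i−j}(β/3)]` for the SU(3) mean plaquette (R. C. Brower,
P. Rossi, C.-I. Tan, Nucl. Phys. B 190 (1981) 699) as a theorem about the cell's definitions; the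
termwise derivative of the Bessel series is NOT taken here (the series side of the numerator is
`OnePlaquetteSU3PlaquetteBessel.integral2_plaqSU3_numerator_eq_tsum_det`).  NOT here: strict
monotonicity / strict positivity of the variance (needs `plaq` non-constant on a set of positive
measure, not typed), higher derivatives (GHS/convexity statements), the 2-d torus.  Nothing is cited as
a fact; no `def`.
-/

noncomputable section

open scoped Nat Topology
open Real MeasureTheory Set Finset Literature.Analysis.FunctionSpaces

namespace Summit.Ventures.LatticeQCDFlow.Scoring

/-! ### 1. Positivity of `Z₃` -/

/-- `|Δ|² ≤ 64` (each factor `2 − 2 cos` is at most `4`). -/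
theorem weylSU3_le (θ₁ θ₂ : ℝ) : weylSU3 θ₁ θ₂ ≤ 64 := by
  unfold weylSU3
  have h1 := Real.neg_one_le_cos (θ₁ - θ₂)
  have h2 := Real.neg_one_le_cos (2 * θ₁ + θ₂)
  have h3 := Real.neg_one_le_cos (θ₁ + 2 * θ₂)
  have h1' := Real.cos_le_one (θ₁ - θ₂)
  have h2' := Real.cos_le_one (2 * θ₁ + θ₂)
  have h3' := Real.cos_le_one (θ₁ + 2 * θ₂)
  have hA : 2 - 2 * Real.cos (θ₁ - θ₂) ≤ 4 := by linarith
  have hB : 2 - 2 * Real.cos (2 * θ₁ + θ₂) ≤ 4 := by linarith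
  have hC : 2 - 2 * Real.cos (θ₁ + 2 * θ₂) ≤ 4 := by linarith
  have hA0 : 0 ≤ 2 - 2 * Real.cos (θ₁ - θ₂) := by linarith
  have hB0 : 0 ≤ 2 - 2 * Real.cos (2 * θ₁ + θ₂) := by linarith
  have hAB : (2 - 2 * Real.cos (θ₁ - θ₂)) * (2 - 2 * Real.cos (2 * θ₁ + θ₂)) ≤ 4 * 4 :=
    mul_le_mul hA hB hB0 (by norm_num)
  calc (2 - 2 * Real.cos (θ₁ - θ₂)) * (2 - 2 * Real.cos (2 * θ₁ + θ₂))
        * (2 - 2 * Real.cos (θ₁ + 2 * θ₂))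
      ≤ (4 * 4) * 4 := mul_le_mul hAB hC (by linarith) (by norm_num)
    _ = 64 := by norm_num

/-- A lower bound: `Z₃(β) ≥ 6 (2π)² e^{−|β|}` (since `(β/3) Re tr U ≥ −|β|`). -/
theorem onePlaquetteZSU3_ge (β : ℝ) : 6 * (2 * π) ^ 2 * Real.exp (-|β|) ≤ onePlaquetteZSU3 β := by
  have hexp : ∀ θ₁ θ₂ : ℝ, Real.exp (-|β|) ≤ Real.exp (β / 3 * reTrSU3 θ₁ θ₂) := by
    intro θ₁ θ₂
    apply Real.exp_le_exp.mpr
    have h := abs_reTrSU3_le θ₁ θ₂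
    have : |β / 3 * reTrSU3 θ₁ θ₂| ≤ |β| := by
      rw [abs_mul, abs_div, abs_of_pos (by norm_num : (0:ℝ) < 3)]
      calc |β| / 3 * |reTrSU3 θ₁ θ₂| ≤ |β| / 3 * 3 := by gcongr
        _ = |β| := by ring
    linarith [neg_abs_le (β / 3 * reTrSU3 θ₁ θ₂)]
  have hsub : onePlaquetteZSU3 β - 6 * (2 * π) ^ 2 * Real.exp (-|β|)
      = ∫ θ₁ in (0 : ℝ)..2 * π, ∫ θ₂ in (0 : ℝ)..2 * π,
          weylSU3 θ₁ θ₂ * (Real.exp (β / 3 * reTrSU3 θ₁ θ₂) - Real.exp (-|β|)) := by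
    have hc : (∫ θ₁ in (0 : ℝ)..2 * π, ∫ θ₂ in (0 : ℝ)..2 * π, Real.exp (-|β|) * weylSU3 θ₁ θ₂)
        = 6 * (2 * π) ^ 2 * Real.exp (-|β|) := by
      rw [integral2_const_mul, integral2_weylSU3]; ring
    rw [← hc, onePlaquetteZSU3, ← integral2_sub (by fun_prop) (by fun_prop)]
    congr 1; funext θ₁; congr 1; funext θ₂; ring
  have hnn : 0 ≤ ∫ θ₁ in (0 : ℝ)..2 * π, ∫ θ₂ in (0 : ℝ)..2 * π,
      weylSU3 θ₁ θ₂ * (Real.exp (β / 3 * reTrSU3 θ₁ θ₂) - Real.exp (-|β|)) := by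
    refine intervalIntegral.integral_nonneg (by positivity) fun θ₁ _ => ?_
    refine intervalIntegral.integral_nonneg (by positivity) fun θ₂ _ => ?_
    exact mul_nonneg (weylSU3_nonneg θ₁ θ₂) (sub_nonneg.mpr (hexp θ₁ θ₂))
  linarith

/-- **`Z₃(β) > 0`** for every real `β`. -/
theorem onePlaquetteZSU3_pos (β : ℝ) : 0 < onePlaquetteZSU3 β :=
  lt_of_lt_of_le (by positivity) (onePlaquetteZSU3_ge β)

/-! ### 2. Differentiation under the integral sign -/

/-- **Differentiating the Wilson weight in `β`**: for a bounded jointly continuous `g`,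
`d/dβ ∫∫ g |Δ|² e^{(β/3) Re tr U} = ∫∫ (g · (1/3) Re tr U) |Δ|² e^{(β/3) Re tr U}`
(dominated differentiation on the torus box `(0,2π]²`, then back to the iterated integral). -/
theorem hasDerivAt_integral2_weight {g : ℝ → ℝ → ℝ} (hg : Continuous fun p : ℝ × ℝ => g p.1 p.2)
    {B : ℝ} (hB : ∀ θ₁ θ₂, |g θ₁ θ₂| ≤ B) (β : ℝ) :
    HasDerivAt (fun b => ∫ θ₁ in (0 : ℝ)..2 * π, ∫ θ₂ in (0 : ℝ)..2 * π,
        g θ₁ θ₂ * (weylSU3 θ₁ θ₂ * Real.exp (b / 3 * reTrSU3 θ₁ θ₂)))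
      (∫ θ₁ in (0 : ℝ)..2 * π, ∫ θ₂ in (0 : ℝ)..2 * π,
        g θ₁ θ₂ * plaqSU3 θ₁ θ₂ * (weylSU3 θ₁ θ₂ * Real.exp (β / 3 * reTrSU3 θ₁ θ₂))) β := by
  -- move to the torus box
  have hbox : (fun b => ∫ θ₁ in (0 : ℝ)..2 * π, ∫ θ₂ in (0 : ℝ)..2 * π,
        g θ₁ θ₂ * (weylSU3 θ₁ θ₂ * Real.exp (b / 3 * reTrSU3 θ₁ θ₂)))
      = fun b => ∫ θ in u1TorusBox 2,
          g (θ 0) (θ 1) * (weylSU3 (θ 0) (θ 1) * Real.exp (b / 3 * reTrSU3 (θ 0) (θ 1))) := by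
    funext b
    exact integral2_eq_setIntegral_u1TorusBox (by fun_prop)
  rw [hbox, integral2_eq_setIntegral_u1TorusBox (by fun_prop)]
  -- dominated differentiation
  set μ : Measure (Fin 2 → ℝ) := (volume : Measure (Fin 2 → ℝ)).restrict (u1TorusBox 2) with hμ
  haveI : IsFiniteMeasure μ := by
    rw [hμ]; exact isFiniteMeasure_restrict.mpr (volume_u1TorusBox_ne_top 2)
  set F : ℝ → (Fin 2 → ℝ) → ℝ := fun b θ =>
    g (θ 0) (θ 1) * (weylSU3 (θ 0) (θ 1) * Real.exp (b / 3 * reTrSU3 (θ 0) (θ 1))) with hF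
  set F' : ℝ → (Fin 2 → ℝ) → ℝ := fun b θ =>
    g (θ 0) (θ 1) * plaqSU3 (θ 0) (θ 1)
      * (weylSU3 (θ 0) (θ 1) * Real.exp (b / 3 * reTrSU3 (θ 0) (θ 1))) with hF'
  have hB0 : 0 ≤ B := le_trans (abs_nonneg _) (hB 0 0)
  have hFc : ∀ b, Continuous (F b) := fun b => by simp only [hF]; fun_prop
  have hF'c : ∀ b, Continuous (F' b) := fun b => by simp only [hF']; fun_prop
  have h := hasDerivAt_integral_of_dominated_loc_of_deriv_le (μ := μ) (F := F) (F' := F') (x₀ := β)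
    (bound := fun _ => B * 1 * (64 * Real.exp (|β| + 1))) (Metric.ball_mem_nhds β zero_lt_one)
    (Filter.Eventually.of_forall fun b => (hFc b).aestronglyMeasurable)
    (by rw [hμ]; exact integrableOn_u1TorusBox (hFc β))
    (hF'c β).aestronglyMeasurable ?_ (integrable_const _) ?_
  · exact h.2
  · -- the bound on the ball of radius 1
    refine Filter.Eventually.of_forall fun θ b hb => ?_
    have hb' : |b| ≤ |β| + 1 := by
      have := Metric.mem_ball.mp hb
      rw [Real.dist_eq] at this
      linarith [abs_sub_abs_le_abs_sub b β]
    simp only [hF', Real.norm_eq_abs, abs_mul]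
    have hexp : |Real.exp (b / 3 * reTrSU3 (θ 0) (θ 1))| ≤ Real.exp (|β| + 1) := by
      rw [abs_of_pos (Real.exp_pos _)]
      apply Real.exp_le_exp.mpr
      have h3 := abs_reTrSU3_le (θ 0) (θ 1)
      have : |b / 3 * reTrSU3 (θ 0) (θ 1)| ≤ |b| := by
        rw [abs_mul, abs_div, abs_of_pos (by norm_num : (0:ℝ) < 3)]
        calc |b| / 3 * |reTrSU3 (θ 0) (θ 1)| ≤ |b| / 3 * 3 := by gcongr
          _ = |b| := by ring
      linarith [le_abs_self (b / 3 * reTrSU3 (θ 0) (θ 1))]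
    have hw : |weylSU3 (θ 0) (θ 1)| ≤ 64 := by
      rw [abs_of_nonneg (weylSU3_nonneg _ _)]; exact weylSU3_le _ _
    gcongr
    · exact hB _ _
    · exact abs_plaqSU3_le _ _
  · -- pointwise derivative
    refine Filter.Eventually.of_forall fun θ b _ => ?_
    simp only [hF, hF']
    have hd : HasDerivAt (fun b : ℝ => b / 3 * reTrSU3 (θ 0) (θ 1))
        (1 / 3 * reTrSU3 (θ 0) (θ 1)) b := by
      simpa using ((hasDerivAt_id b).div_const 3).mul_const (reTrSU3 (θ 0) (θ 1))
    have he := (hd.exp.const_mul (weylSU3 (θ 0) (θ 1))).const_mul (g (θ 0) (θ 1))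
    refine he.congr_deriv ?_
    simp only [plaqSU3]
    ring

/-- **`dZ₃/dβ`** is the plaquette numerator: `Z₃'(β) = ∫∫ (1/3) Re tr U |Δ|² e^{(β/3) Re tr U}`. -/
theorem hasDerivAt_onePlaquetteZSU3 (β : ℝ) :
    HasDerivAt onePlaquetteZSU3 (∫ θ₁ in (0 : ℝ)..2 * π, ∫ θ₂ in (0 : ℝ)..2 * π,
        plaqSU3 θ₁ θ₂ * (weylSU3 θ₁ θ₂ * Real.exp (β / 3 * reTrSU3 θ₁ θ₂))) β := by
  have h := hasDerivAt_integral2_weight (g := fun _ _ => (1 : ℝ)) (by fun_prop) (B := 1)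
    (fun _ _ => by simp) β
  simp only [one_mul] at h
  exact h

/-- The derivative of the plaquette numerator:
`d/dβ ∫∫ plaq |Δ|² e^{(β/3) Re tr U} = ∫∫ plaq² |Δ|² e^{(β/3) Re tr U}`. -/
theorem hasDerivAt_plaqSU3_numerator (β : ℝ) :
    HasDerivAt (fun b => ∫ θ₁ in (0 : ℝ)..2 * π, ∫ θ₂ in (0 : ℝ)..2 * π,
        plaqSU3 θ₁ θ₂ * (weylSU3 θ₁ θ₂ * Real.exp (b / 3 * reTrSU3 θ₁ θ₂)))
      (∫ θ₁ in (0 : ℝ)..2 * π, ∫ θ₂ in (0 : ℝ)..2 * π,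
        plaqSU3 θ₁ θ₂ * plaqSU3 θ₁ θ₂ * (weylSU3 θ₁ θ₂ * Real.exp (β / 3 * reTrSU3 θ₁ θ₂))) β :=
  hasDerivAt_integral2_weight (g := plaqSU3) (by fun_prop) (B := 1) abs_plaqSU3_le β

/-! ### 3. The plaquette is the derivative of the free energy and is non-decreasing in `β` -/

/-- **`⟨(1/3) Re tr U_p⟩_β = (d/dβ) log Z₃(β)`**: the SU(3) one-plaquette plaquette is the
`β`-derivative of the one-plaquette free energy. -/
theorem onePlaquetteExpectSU3_plaqSU3_eq_deriv_log (β : ℝ) :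
    onePlaquetteExpectSU3 β plaqSU3 = deriv (fun b => Real.log (onePlaquetteZSU3 b)) β := by
  rw [((hasDerivAt_onePlaquetteZSU3 β).log (onePlaquetteZSU3_pos β).ne').deriv,
    onePlaquetteExpectSU3]

/-- **The `β`-derivative of the plaquette is its variance**:
`d⟨plaq⟩_β/dβ = ⟨plaq²⟩_β − ⟨plaq⟩_β²` (the one-plaquette "specific heat"). -/
theorem hasDerivAt_onePlaquetteExpectSU3_plaqSU3 (β : ℝ) :
    HasDerivAt (fun b => onePlaquetteExpectSU3 b plaqSU3)
      (onePlaquetteExpectSU3 β (fun θ₁ θ₂ => plaqSU3 θ₁ θ₂ * plaqSU3 θ₁ θ₂)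
        - onePlaquetteExpectSU3 β plaqSU3 ^ 2) β := by
  have hne := (onePlaquetteZSU3_pos β).ne'
  have h := (hasDerivAt_plaqSU3_numerator β).div (hasDerivAt_onePlaquetteZSU3 β) hne
  have hfun : (fun b => onePlaquetteExpectSU3 b plaqSU3)
      = (fun b => ∫ θ₁ in (0 : ℝ)..2 * π, ∫ θ₂ in (0 : ℝ)..2 * π,
          plaqSU3 θ₁ θ₂ * (weylSU3 θ₁ θ₂ * Real.exp (b / 3 * reTrSU3 θ₁ θ₂)))
        / onePlaquetteZSU3 := by
    funext b
    simp only [onePlaquetteExpectSU3, Pi.div_apply]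
  rw [hfun]
  refine h.congr_deriv ?_
  simp only [onePlaquetteExpectSU3]
  field_simp

/-- **The variance is non-negative**: `⟨plaq⟩_β² ≤ ⟨plaq²⟩_β`
(expand `0 ≤ ∫∫ (plaq − ⟨plaq⟩)² |Δ|² e^{…}`). -/
theorem onePlaquetteExpectSU3_plaqSU3_sq_le (β : ℝ) :
    onePlaquetteExpectSU3 β plaqSU3 ^ 2
      ≤ onePlaquetteExpectSU3 β (fun θ₁ θ₂ => plaqSU3 θ₁ θ₂ * plaqSU3 θ₁ θ₂) := by
  have hZ : 0 < onePlaquetteZSU3 β := onePlaquetteZSU3_pos β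
  set N := ∫ θ₁ in (0 : ℝ)..2 * π, ∫ θ₂ in (0 : ℝ)..2 * π,
    plaqSU3 θ₁ θ₂ * (weylSU3 θ₁ θ₂ * Real.exp (β / 3 * reTrSU3 θ₁ θ₂)) with hN
  set S := ∫ θ₁ in (0 : ℝ)..2 * π, ∫ θ₂ in (0 : ℝ)..2 * π,
    plaqSU3 θ₁ θ₂ * plaqSU3 θ₁ θ₂ * (weylSU3 θ₁ θ₂ * Real.exp (β / 3 * reTrSU3 θ₁ θ₂)) with hS
  set u := N / onePlaquetteZSU3 β with hu
  -- `0 ≤ ∫∫ (plaq − u)² W = S − 2uN + u² Z`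
  have hnn : 0 ≤ ∫ θ₁ in (0 : ℝ)..2 * π, ∫ θ₂ in (0 : ℝ)..2 * π,
      (plaqSU3 θ₁ θ₂ - u) ^ 2 * (weylSU3 θ₁ θ₂ * Real.exp (β / 3 * reTrSU3 θ₁ θ₂)) := by
    refine intervalIntegral.integral_nonneg (by positivity) fun θ₁ _ => ?_
    refine intervalIntegral.integral_nonneg (by positivity) fun θ₂ _ => ?_
    exact mul_nonneg (sq_nonneg _) (mul_nonneg (weylSU3_nonneg θ₁ θ₂) (Real.exp_nonneg _))
  have hpt : ∀ θ₁ θ₂ : ℝ,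
      (plaqSU3 θ₁ θ₂ - u) ^ 2 * (weylSU3 θ₁ θ₂ * Real.exp (β / 3 * reTrSU3 θ₁ θ₂))
        = (plaqSU3 θ₁ θ₂ * plaqSU3 θ₁ θ₂ * (weylSU3 θ₁ θ₂ * Real.exp (β / 3 * reTrSU3 θ₁ θ₂))
            - 2 * u * (plaqSU3 θ₁ θ₂ * (weylSU3 θ₁ θ₂ * Real.exp (β / 3 * reTrSU3 θ₁ θ₂))))
          + u ^ 2 * (weylSU3 θ₁ θ₂ * Real.exp (β / 3 * reTrSU3 θ₁ θ₂)) := by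
    intro θ₁ θ₂; ring
  simp_rw [hpt] at hnn
  rw [integral2_add (by fun_prop) (by fun_prop), integral2_sub (by fun_prop) (by fun_prop),
    integral2_const_mul, integral2_const_mul, ← hS, ← hN, ← onePlaquetteZSU3] at hnn
  -- `S − 2uN + u²Z = S − N²/Z ≥ 0`, i.e. `u² ≤ S/Z`
  have h1 : S - 2 * u * N + u ^ 2 * onePlaquetteZSU3 β = S - N ^ 2 / onePlaquetteZSU3 β := by
    rw [hu]; field_simp; ring
  have h2 : N ^ 2 ≤ S * onePlaquetteZSU3 β := by
    have : N ^ 2 / onePlaquetteZSU3 β ≤ S := by linarith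
    rwa [div_le_iff₀ hZ] at this
  show u ^ 2 ≤ S / onePlaquetteZSU3 β
  rw [hu, div_pow, div_le_div_iff₀ (pow_pos hZ 2) hZ]
  nlinarith

/-- **THE SU(3) ONE-PLAQUETTE PLAQUETTE IS NON-DECREASING IN `β`** (its derivative is a
variance). -/
theorem monotone_onePlaquetteExpectSU3_plaqSU3 :
    Monotone fun β => onePlaquetteExpectSU3 β plaqSU3 := by
  apply monotone_of_deriv_nonneg
  · exact fun β => (hasDerivAt_onePlaquetteExpectSU3_plaqSU3 β).differentiableAt
  · intro β
    rw [(hasDerivAt_onePlaquetteExpectSU3_plaqSU3 β).deriv]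
    exact sub_nonneg.mpr (onePlaquetteExpectSU3_plaqSU3_sq_le β)

/-- At `β = 0` the plaquette vanishes (`∫∫ |Δ|² Re tr U = 0`, GEN-6: `∫_{SU(3)} tr U dU = 0`). -/
theorem onePlaquetteExpectSU3_plaqSU3_zero : onePlaquetteExpectSU3 0 plaqSU3 = 0 := by
  have hpt : ∀ θ₁ θ₂ : ℝ, plaqSU3 θ₁ θ₂ * (weylSU3 θ₁ θ₂ * Real.exp (0 / 3 * reTrSU3 θ₁ θ₂))
      = 1 / 3 * (weylSU3 θ₁ θ₂ * reTrSU3 θ₁ θ₂) := by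
    intro θ₁ θ₂
    rw [zero_div, zero_mul, Real.exp_zero, mul_one, plaqSU3]
    ring
  unfold onePlaquetteExpectSU3
  simp_rw [hpt]
  rw [integral2_const_mul, integral2_weylSU3_mul_reTrSU3, mul_zero, zero_div]

/-- Hence **`⟨plaq⟩_β ≥ 0` for `β ≥ 0`** (and `≤ 0` for `β ≤ 0`, next). -/
theorem onePlaquetteExpectSU3_plaqSU3_nonneg {β : ℝ} (hβ : 0 ≤ β) :
    0 ≤ onePlaquetteExpectSU3 β plaqSU3 := by
  simpa only [onePlaquetteExpectSU3_plaqSU3_zero] using monotone_onePlaquetteExpectSU3_plaqSU3 hβ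

/-- `⟨plaq⟩_β ≤ 0` for `β ≤ 0`. -/
theorem onePlaquetteExpectSU3_plaqSU3_nonpos {β : ℝ} (hβ : β ≤ 0) :
    onePlaquetteExpectSU3 β plaqSU3 ≤ 0 := by
  simpa only [onePlaquetteExpectSU3_plaqSU3_zero] using monotone_onePlaquetteExpectSU3_plaqSU3 hβ

/-! ### 4. Convexity of the free energy and the strong-coupling slope (appended 2026-08-23, GEN-16) -/

/-- **The SU(3) one-plaquette free energy `log Z₃` is convex** (its derivative, the plaquette, is
monotone). -/
theorem convexOn_log_onePlaquetteZSU3 : ConvexOn ℝ Set.univ fun β => Real.log (onePlaquetteZSU3 β) := by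
  have hd : ∀ β, HasDerivAt (fun b => Real.log (onePlaquetteZSU3 b)) (onePlaquetteExpectSU3 β plaqSU3) β :=
    fun β => by
      have h := (hasDerivAt_onePlaquetteZSU3 β).log (onePlaquetteZSU3_pos β).ne'
      refine h.congr_deriv ?_
      rw [onePlaquetteExpectSU3]
  refine Monotone.convexOn_univ_of_deriv (fun β => (hd β).differentiableAt) ?_
  have hderiv : deriv (fun b => Real.log (onePlaquetteZSU3 b)) = fun β => onePlaquetteExpectSU3 β plaqSU3 :=
    funext fun β => (hd β).deriv
  rw [hderiv]
  exact monotone_onePlaquetteExpectSU3_plaqSU3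

/-- At `β = 0` the second moment of the plaquette is `1/18` (`⟨(Re tr U)²⟩_{SU(3)} = 1/2`, GEN-6). -/
theorem onePlaquetteExpectSU3_plaqSq_zero :
    onePlaquetteExpectSU3 0 (fun θ₁ θ₂ => plaqSU3 θ₁ θ₂ * plaqSU3 θ₁ θ₂) = 1 / 18 := by
  have hpt : ∀ θ₁ θ₂ : ℝ, plaqSU3 θ₁ θ₂ * plaqSU3 θ₁ θ₂
        * (weylSU3 θ₁ θ₂ * Real.exp (0 / 3 * reTrSU3 θ₁ θ₂))
      = 1 / 9 * (weylSU3 θ₁ θ₂ * reTrSU3 θ₁ θ₂ ^ 2) := by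
    intro θ₁ θ₂
    rw [zero_div, zero_mul, Real.exp_zero, mul_one, plaqSU3]
    ring
  have hZ : onePlaquetteZSU3 0 = (2 * π) ^ 2 * 6 := by
    rw [onePlaquetteZSU3]
    simp only [zero_div, zero_mul, Real.exp_zero, mul_one]
    exact integral2_weylSU3
  unfold onePlaquetteExpectSU3
  simp_rw [hpt]
  rw [integral2_const_mul, integral2_weylSU3_mul_reTrSU3_sq, hZ]
  have hπ : (2 * π : ℝ) ^ 2 ≠ 0 := by positivity
  field_simp
  ring

/-- **THE STRONG-COUPLING SLOPE OF THE SU(3) PLAQUETTE IS `1/18`**: `d⟨(1/3) Re tr U_p⟩_β/dβ |_{β=0} = 1/18`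
(the variance at `β = 0`; the leading strong-coupling coefficient `u(β) = β/18 + O(β²)` of the SU(3)
Wilson plaquette). -/
theorem hasDerivAt_onePlaquetteExpectSU3_plaqSU3_zero :
    HasDerivAt (fun b => onePlaquetteExpectSU3 b plaqSU3) (1 / 18) 0 := by
  have h := hasDerivAt_onePlaquetteExpectSU3_plaqSU3 0
  rw [onePlaquetteExpectSU3_plaqSq_zero, onePlaquetteExpectSU3_plaqSU3_zero] at h
  simpa using h

end Summit.Ventures.LatticeQCDFlow.Scoring
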